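import Summits.CriticalPhenomena.PercolationContinuityZ3.Theorems.PercNearOneGluingNoHeavyLowerTailFKKNFintype
import HarnessLib

/-!
# FRONTIER TRANSPLANT, row FT-03(b): SET-TARGET additive gluing for the random-cluster measures `φ_{w,q}`, `q ≥ 1`,
# on every finite weighted graph — `φ(o ↔ T) ≥ φ(o ↔ A) − max_{a ∈ A} φ(a ↮ T)` for a target SET `T`

Support file (`--supports stmt-CriticalPhenomena-4575`, helper) of the FRONTIER TRANSPLANT sub-cell (`fk-continuity/transplant/`,
registry row FT-03, seat `prim-bschramm-fkt-p1`); builds on p205010 (kernel theorem, internal audit signed; external expert review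
pending).  No definitions, no named facts, no sorries; standard axioms.

HONEST FRAMING (page 1, cell rule).  The transplant's theorem of record `ufsc0_of_freeBoundaryHypothesis_r0 : FH 3 q p → … → ∃ r, UFSC0 3 q p r ε₀`
is CONDITIONAL on the free-boundary penetration hypothesis FH, which is OPEN at the same `p` for every `q > 1`; by the referee's
calibration K1, [C3a for all `p > p_c(q)`] ∧ C3b forces `p̂_c(q) = p_c(q)`, i.e. Grimmett's Conjecture (5.103) / Duminil-Copin–Tassion's Question 5 (arXiv:1707.07626,
p. 9), open for `q ∈ (1,2)` — see the barrier note `SamePFreeBoundaryCriteria` (cell row FBN-01, `Literature/Barriers/CriticalPhenomena/`, cited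
statements only) and `FO-19-RECOMMENDATION.md` (NO-GO on criterion 1).  The transplant is a typed reduction, not a proof of FK continuity.
THIS FILE, however, is an UNCONDITIONAL finite-graph correlation inequality: it uses no hypothesis of the transplant and no infinite-volume
object, and is valid for every `q ≥ 1` and every parameter vector `w ∈ [0,1]^{Sym2 V}`.

WHY IT IS NEEDED (refuter finding F3, `prim-bschramm-fkp-18r/REFUTER-REPORT.md` §8.1).  Kozma–Nitzan glue the explored cluster to a SET
target `T` (a box) by "identifying the set `T` to a point" (arXiv:2401.12397, p. 22, l. 1–4); at `q = 1` this is an identity of the product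
measure (`KozmaNitzan2024_conjecture3.openConn_set` via `prodBernoulli_wireW_real_openConn`), but for `q > 1` wiring `T` tilts `φ` by
`q^{−(N_T − 1)}` (an increasing tilt), so the tree's POINT-target gluing `FK.additiveGluingFK_of_one_le` / `FK.additiveGluing_rc_fintype`
applied in the `T`-wired graph concludes about the wrong (larger) measure.  Set targets are intrinsic to the scheme (the boxes `M_x` of
Thm. 6 Step III / Lemma 12, pp. 24–25; hyperplane pieces in Lemma 11, p. 23), so every FK transplant that keeps a gluing step needs:

> for every finite weighted graph, every `q ≥ 1`, relays `A`, observer `o`, target set `T` and slack `t ≥ max_{a∈A} φ(a ↮ T)`: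
> `φ_{w,q}(o ↔ T) ≥ φ_{w,q}(o ↔ A) − t`.

PROOF (≈ 60 lines instead of the 300–800 estimated in F3, because the tree already holds Kozma–Nitzan's CONJECTURE 4 for `φ_{w,q}`, `q ≥ 1`,
with an ARBITRARY monotone cluster property — `FK.kn_conj4_rc_fintype`, fk-2 gen 5).  For a monotone cluster property `F` with values in
`[0,1]`, Conjecture 4 gives a relay `a ∈ A` with `E[F(C(a)); o ↔ A] ≤ E[F(C(o)); o ↔ A]`; the left side is `≥ E F(C(a)) − φ(o ↮ A) ≥ φ(o ↔ A) − t`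
and the right side is `≤ E F(C(o))`.  This is the FUNCTIONAL additive gluing `FK.clusterFun_additiveGluing_rc`; the set-target statement is
`F = 1{C meets T}` (`FK.setTarget_additiveGluing_rc`), the near-one (`∀ ε ∃ δ`, Kozma–Nitzan Conj. 3 shape) form is
`FK.setTarget_nearOneGluing_rc` (`δ = ε/2`), and `T = {b}` re-derives the point-target `FK.additiveGluing_rc_fintype` (sanity `example`).
Everything is over an ARBITRARY finite vertex type `V` and every `w ∈ [0,1]^{Sym2 V}` (weight `0` = absent edge, weight `1` = almost surely
open pair, so every finite graph with revealed-open edges kept / revealed-closed edges deleted — the conditioned laws `K_σ`, `P^x = P_{R_x,h}`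
of the transplant, `rcMeasureW (condWeights w F ξ) q ∅` — is covered); free boundary condition `B = ∅` in `rcMeasureW` (a wired vertex
set is to be emulated by weight-`1` pairs along a spanning tree, consumer-side).
[cite: KozmaNitzan2024, Conj. 1 and Conj. 2 (p. 3), Conj. 3 (p. 15), p. 22 l. 1–4 ("we identified the set T to a point"), Conj. 4 (p. 32)]
[cite: Grimmett2006, §1.4 eq. (1.20) (p. 15); Thm. (3.8); Conj. (5.103) (p. 122)]
-/

noncomputable section

namespace Summit.CriticalPhenomena.PercolationContinuityZ3.Theorems

open MeasureTheory Set Literature.Probability.LatticeModels Literature.Probability.Percolation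
open scoped Classical

namespace FK

universe u

variable {V : Type u} [Fintype V]

/-- **Functional additive gluing for `φ_{w,q}`, `q ≥ 1`** (every finite vertex type, every `w ∈ [0,1]^{Sym2 V}`): for a monotone cluster
property `F` with values in `[0,1]`, relays `A`, an observer `o` and a slack `t ≥ 0` with `E_φ F(C(a)) ≥ 1 − t` for every `a ∈ A`,
`E_φ F(C(o)) ≥ φ(o ↔ A) − t`.  From Kozma–Nitzan's Conjecture 4 for `φ_{w,q}` (`FK.kn_conj4_rc_fintype`): some `a ∈ A` has
`E[F(C(a)); o ↔ A] ≤ E[F(C(o)); o ↔ A] ≤ E F(C(o))`, while `E[F(C(a)); o ↔ A] ≥ E F(C(a)) − φ(o ↮ A) ≥ φ(o ↔ A) − t` (`F ≤ 1`).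
[cite: KozmaNitzan2024, Conj. 4 (p. 32), Conj. 1 (p. 3)] [cite: Grimmett2006, §1.4 eq. (1.20) (p. 15)] -/
theorem clusterFun_additiveGluing_rc {q : ℝ} (hq : 1 ≤ q) (w : Sym2 V → unitInterval) (A : Finset V) (o : V)
    (F : Set V → ℝ) (hF : ∀ S S' : Set V, S ⊆ S' → F S ≤ F S') (hF0 : ∀ S, 0 ≤ F S) (hF1 : ∀ S, F S ≤ 1)
    {t : ℝ} (ht : 0 ≤ t) (hrel : ∀ a ∈ A, 1 - t ≤ ∫ ω, F (openCluster ω a) ∂(rcMeasureW w q ∅)) :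
    (rcMeasureW w q ∅).real (⋃ a ∈ A, openConn o a) - t ≤ ∫ ω, F (openCluster ω o) ∂(rcMeasureW w q ∅) := by
  have hq0 : 0 < q := one_pos.trans_le hq
  haveI := isProbabilityMeasure_rcMeasureW w hq0 (∅ : Set V)
  set μ := rcMeasureW w q ∅ with hμ
  have hmeas : ∀ S : Set (BondConfig V), MeasurableSet S := fun _ => MeasurableSet.of_discrete
  have hint : ∀ g : BondConfig V → ℝ, Integrable g μ := fun _ => Integrable.of_finite
  have hFo0 : 0 ≤ ∫ ω, F (openCluster ω o) ∂μ := integral_nonneg fun ω => hF0 _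
  rcases A.eq_empty_or_nonempty with hA | hA
  · subst hA
    simp only [Finset.notMem_empty, iUnion_of_empty, iUnion_empty, measureReal_empty]
    linarith
  obtain ⟨a, ha, hle⟩ := kn_conj4_rc_fintype hq V w A o F hF hA
  set S : Set (BondConfig V) := ⋃ a' ∈ A, (openConn o a' : Set (BondConfig V)) with hS
  -- right side: `E[F(C(o)); o ↔ A] ≤ E F(C(o))`
  have h1 : ∫ ω in S, F (openCluster ω o) ∂μ ≤ ∫ ω, F (openCluster ω o) ∂μ :=
    setIntegral_le_integral (hint _) (Filter.Eventually.of_forall fun ω => hF0 _)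
  -- left side: `E[F(C(a)); o ↔ A] = E F(C(a)) − E[F(C(a)); o ↮ A] ≥ (1 − t) − φ(o ↮ A)`
  have h2 : ∫ ω in S, F (openCluster ω a) ∂μ + ∫ ω in Sᶜ, F (openCluster ω a) ∂μ = ∫ ω, F (openCluster ω a) ∂μ :=
    integral_add_compl (hmeas S) (hint _)
  have h3 : ∫ ω in Sᶜ, F (openCluster ω a) ∂μ ≤ μ.real Sᶜ := by
    have h := setIntegral_mono (s := Sᶜ) (hint _).integrableOn (hint fun _ => (1 : ℝ)).integrableOn fun ω => hF1 (openCluster ω a)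
    simpa only [setIntegral_const, smul_eq_mul, mul_one] using h
  have h4 : μ.real Sᶜ = 1 - μ.real S := probReal_compl_eq_one_sub (hmeas S)
  have h5 := hrel a ha
  linarith

/-- The indicator of "`C(x)` meets `T`" is the indicator of the event `⋃_{s ∈ T} {x ↔ s}`. [folklore] -/
theorem meetsInd_openCluster_eq_indicator (T : Set V) (x : V) :
    (fun ω : BondConfig V => if ∃ s ∈ T, s ∈ openCluster ω x then (1 : ℝ) else 0) =
      (⋃ s ∈ T, (openConn x s : Set (BondConfig V))).indicator 1 := by
  funext ω
  have hiff : (∃ s ∈ T, s ∈ openCluster ω x) ↔ ω ∈ ⋃ s ∈ T, (openConn x s : Set (BondConfig V)) := by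
    simp only [mem_iUnion, exists_prop]
    exact Iff.rfl
  by_cases h : ∃ s ∈ T, s ∈ openCluster ω x
  · rw [if_pos h, indicator_of_mem (hiff.1 h), Pi.one_apply]
  · rw [if_neg h, indicator_of_notMem (fun h' => h (hiff.2 h'))]

/-- `E_μ 1{C(x) meets T} = μ(⋃_{s ∈ T} {x ↔ s})`, for any measure on the (discrete) configuration space. [folklore] -/
theorem integral_meetsInd_openCluster (μ : Measure (BondConfig V)) (T : Set V) (x : V) :
    ∫ ω, (if ∃ s ∈ T, s ∈ openCluster ω x then (1 : ℝ) else 0) ∂μ = μ.real (⋃ s ∈ T, openConn x s) := by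
  calc ∫ ω, (if ∃ s ∈ T, s ∈ openCluster ω x then (1 : ℝ) else 0) ∂μ
      = ∫ ω, (⋃ s ∈ T, (openConn x s : Set (BondConfig V))).indicator 1 ω ∂μ :=
        integral_congr_ae (Filter.Eventually.of_forall fun ω => congrFun (meetsInd_openCluster_eq_indicator T x) ω)
    _ = μ.real (⋃ s ∈ T, openConn x s) := integral_indicator_one MeasurableSet.of_discrete

/-- **SET-TARGET ADDITIVE GLUING for `φ_{w,q}`, `q ≥ 1`, on every finite weighted graph** (refuter F3's missing lemma): for relays `A`,
an observer `o`, a target SET `T` and a slack `t ≥ 0` with `φ(a ↔ T) ≥ 1 − t` for every `a ∈ A`,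
`φ_{w,q}(o ↔ T) ≥ φ_{w,q}(o ↔ A) − t`, where `{x ↔ T} = ⋃_{s ∈ T} {x ↔ s}`.  (`FK.clusterFun_additiveGluing_rc` with `F = 1{· meets T}`.)
Kozma–Nitzan obtain the `q = 1` case from the point-target statement by identifying `T` to a point (p. 22), which is not available for
`q > 1`. [cite: KozmaNitzan2024, Conj. 1 (p. 3), p. 22 l. 1–4, Conj. 4 (p. 32)] [cite: Grimmett2006, §1.4 eq. (1.20) (p. 15)] -/
theorem setTarget_additiveGluing_rc {q : ℝ} (hq : 1 ≤ q) (w : Sym2 V → unitInterval) (A : Finset V) (T : Set V) (o : V)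
    {t : ℝ} (ht : 0 ≤ t) (hrel : ∀ a ∈ A, 1 - t ≤ (rcMeasureW w q ∅).real (⋃ s ∈ T, openConn a s)) :
    (rcMeasureW w q ∅).real (⋃ a ∈ A, openConn o a) - t ≤ (rcMeasureW w q ∅).real (⋃ s ∈ T, openConn o s) := by
  set F : Set V → ℝ := fun S => if ∃ s ∈ T, s ∈ S then (1 : ℝ) else 0 with hF
  have hFmono : ∀ S S' : Set V, S ⊆ S' → F S ≤ F S' := by
    intro S S' hSS'
    simp only [hF]
    by_cases hS : ∃ s ∈ T, s ∈ S
    · obtain ⟨s, hsT, hsS⟩ := hS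
      rw [if_pos ⟨s, hsT, hsS⟩, if_pos ⟨s, hsT, hSS' hsS⟩]
    · rw [if_neg hS]
      split_ifs <;> norm_num
  have hF0 : ∀ S, 0 ≤ F S := fun S => by simp only [hF]; split_ifs <;> norm_num
  have hF1 : ∀ S, F S ≤ 1 := fun S => by simp only [hF]; split_ifs <;> norm_num
  have key := clusterFun_additiveGluing_rc hq w A o F hFmono hF0 hF1 ht (fun a ha => by
    simp only [hF]
    rw [integral_meetsInd_openCluster]
    exact hrel a ha)
  simp only [hF] at key
  rwa [integral_meetsInd_openCluster] at key

/-- **SET-TARGET NEAR-ONE GLUING for `φ_{w,q}`, `q ≥ 1`** (Kozma–Nitzan's Conjecture 3 shape with a target set, uniformly in the graph,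
the weights, `|A|` and `T`): for every `ε > 0` there is `δ > 0` (namely `ε/2`) such that `φ(o ↔ A) > 1 − δ` and `φ(a ↔ T) > 1 − δ` for all
`a ∈ A` imply `φ(o ↔ T) > 1 − ε`. [cite: KozmaNitzan2024, Conj. 3 (p. 15), p. 22 l. 1–4] [cite: Grimmett2006, §1.4 eq. (1.20) (p. 15)] -/
theorem setTarget_nearOneGluing_rc {q : ℝ} (hq : 1 ≤ q) {ε : ℝ} (hε : 0 < ε) :
    ∃ δ : ℝ, 0 < δ ∧ ∀ (V : Type u) [Fintype V] (w : Sym2 V → unitInterval) (A : Finset V) (T : Set V) (o : V),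
      1 - δ < (rcMeasureW w q ∅).real (⋃ a ∈ A, openConn o a) →
        (∀ a ∈ A, 1 - δ < (rcMeasureW w q ∅).real (⋃ s ∈ T, openConn a s)) →
          1 - ε < (rcMeasureW w q ∅).real (⋃ s ∈ T, openConn o s) := by
  refine ⟨ε / 2, by positivity, fun V _ w A T o hoA hAT => ?_⟩
  have key := setTarget_additiveGluing_rc hq w A T o (t := ε / 2) (by positivity) fun a ha => (hAT a ha).le
  linarith

omit [Fintype V] in
/-- A singleton target is a point target: `⋃_{s ∈ {b}} {x ↔ s} = {x ↔ b}`. [folklore] -/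
theorem biUnion_openConn_singleton (x b : V) :
    (⋃ s ∈ ({b} : Set V), (openConn x s : Set (BondConfig V))) = openConn x b := by
  rw [biUnion_singleton]

/-- Sanity check: with `T = {b}` the set-target statement is the tree's point-target additive gluing under `φ_{w,q}`, `q ≥ 1`
(`FK.additiveGluing_rc_fintype`, re-derived). [cite: KozmaNitzan2024, Conj. 1 (p. 3)] -/
example {q : ℝ} (hq : 1 ≤ q) (w : Sym2 V → unitInterval) (A : Finset V) (o b : V) :
    AdditiveGluingUnder (rcMeasureW w q ∅) A o b := by
  intro t ht hAb
  have key := setTarget_additiveGluing_rc hq w A ({b} : Set V) o ht (fun a ha => by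
    rw [biUnion_openConn_singleton]; exact hAb a ha)
  rwa [biUnion_openConn_singleton] at key

end FK

end Summit.CriticalPhenomena.PercolationContinuityZ3.Theorems

end
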